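import Summits.AnomalousDissipation.AnomalousDissipation.Theorems.BaireTransferRobustLoudUpgradeStubSteadyWindow
import Summits.AnomalousDissipation.AnomalousDissipation.Theorems.DenseLoudDesignerForces.Negative.Scaling

/-!
# Stub `stub_segmentBudget` of the line `malkin-cone-group-orbits`
# (crux stmt-AnomalousDissipation-1144, `BaireTransfer.RobustLoudUpgrade`, reshape c14 "designer segment inside P_S")

Registered signature (proved here, textually):
`theorem stub_segmentBudget : ∀ (ν t : ℝ) (u₀ : UnitAddTorus (Fin 3) → EuclideanSpace ℝ (Fin 3)), IsSmooth u₀ →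
  meanEnergy (fun _ : ℝ => fun x => t • u₀ x) = t ^ 2 * meanEnergy (fun _ : ℝ => u₀) ∧
  meanDissipation ν (fun _ : ℝ => fun x => t • u₀ x) = t ^ 2 * meanDissipation ν (fun _ : ℝ => u₀)`.

Along the designer segment of the reshape the steady witness is `t • u₀`; viewed as time-constant space–time
fields, its long-time mean energy and mean dissipation are `t²` times those of `u₀`:
`⟨‖t u₀‖₂²⟩ = ∫‖t u₀‖² = t² ∫‖u₀‖²` (`SteadyWindow.meanEnergy_const`, `‖t v‖² = t²‖v‖²`) and
`⟨ν‖∇(t u₀)‖₂²⟩ = ν‖∇(t u₀)‖₂² = t² ν‖∇u₀‖₂²` (`SteadyWindow.meanDissipation_const` for the smooth fields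
`u₀`, `t • u₀`, and `DenseLoudDesignerForces.Negative.gradNormSq_const_smul`).  Pure proof file (no definitions).
-/

-- `Summit.<Summit>.<Problem>` is the tree's mandated summit-side namespace (CONVENTIONS §2); for this
-- single-conjunct summit the two coincide, so the duplicate is deliberate.
set_option linter.dupNamespace false

noncomputable section

open scoped BigOperators Topology
open Filter Set Function TopologicalSpace MeasureTheory

namespace Summit.AnomalousDissipation.AnomalousDissipation.Theorems.RobustLoudUpgrade.Poly.SegmentBudget

open Literature.Analysis.FunctionSpaces Literature.Analysis.FunctionSpaces.Torus
open Literature.Analysis.FluidPDE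
open Summit.AnomalousDissipation.AnomalousDissipation.Theses.BaireTransfer
open Summit.AnomalousDissipation.AnomalousDissipation.Theorems.RobustLoudUpgrade

/-- `∫‖t v‖² = t² ∫‖v‖²` on `T³` (`‖t a‖² = t²‖a‖²` pointwise, `integral_const_mul`). [folklore] -/
theorem integral_norm_sq_const_smul (t : ℝ) (v : UnitAddTorus (Fin 3) → EuclideanSpace ℝ (Fin 3)) :
    ∫ x, ‖t • v x‖ ^ 2 = t ^ 2 * ∫ x, ‖v x‖ ^ 2 := by
  rw [← integral_const_mul]
  refine integral_congr_ae (ae_of_all _ fun x => ?_)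
  dsimp only
  rw [norm_smul, mul_pow, Real.norm_eq_abs, sq_abs]

/-- **The registered stub `stub_segmentBudget`** (budgets along the designer segment): the mean energy and the
mean dissipation of the steady field `t • u₀`, as a time-constant space–time field, are `t²` times those of `u₀`
(`SteadyWindow.meanEnergy_const`, `SteadyWindow.meanDissipation_const`, `‖∇(t u)‖₂² = t²‖∇u‖₂²`). [folklore] -/
theorem stub_segmentBudget :
    ∀ (ν t : ℝ) (u₀ : UnitAddTorus (Fin 3) → EuclideanSpace ℝ (Fin 3)), IsSmooth u₀ →
      meanEnergy (fun _ : ℝ => fun x => t • u₀ x) = t ^ 2 * meanEnergy (fun _ : ℝ => u₀) ∧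
        meanDissipation ν (fun _ : ℝ => fun x => t • u₀ x) = t ^ 2 * meanDissipation ν (fun _ : ℝ => u₀) := by
  intro ν t u₀ hu₀
  -- `fun x => t • u₀ x` is definitionally `t • u₀` (`Pi.smul_def`)
  have hsm : IsSmooth (fun x => t • u₀ x) := hu₀.smul t
  refine ⟨?_, ?_⟩
  · rw [SteadyWindow.meanEnergy_const, SteadyWindow.meanEnergy_const]
    exact integral_norm_sq_const_smul t u₀
  · rw [SteadyWindow.meanDissipation_const ν hsm, SteadyWindow.meanDissipation_const ν hu₀]
    have hg : gradNormSq (fun x => t • u₀ x) = t ^ 2 * gradNormSq u₀ :=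
      DenseLoudDesignerForces.Negative.gradNormSq_const_smul hu₀ t
    rw [hg]
    ring

end Summit.AnomalousDissipation.AnomalousDissipation.Theorems.RobustLoudUpgrade.Poly.SegmentBudget

end
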